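/-
Copyright (c) 2026 the pub-hodgecm-mathlib formalisation cell (harness21).  Prover seat hodgecm-mathlib-K2E5-p01 (g4) (free E5 hand, cross-unit), HCML Track B «K2-LIT»,
h413 = `stmt-HodgeConjecture-24833`, line `K2_E3_EllipticInputs`, unit U12, socket #11 road (SC-an), sub-line «HC-D-ε» (sub-lead K2E3-p21 (g3), CONVENTION v1
`K2/STATUS.md` 2026-09-04T02:46:50Z), file (ε1).  Exponent-parametric twin of ★ `F0P3cStCharTSHCDRegularPoints` (F0P3-p04 (g18), road «HC-D» brick D5(i)).  2026-09-04.
-/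
import Summits.HodgeConjecture.HodgeConjecture.Theorems.F0P3cStCharTSHCDRegularPoints   -- ★ D5(i) at `r = 1∕4` (F0P3-p04): §1–§2 algebra (`sigma_trace_adjugate_mul_of_mem`, `skew_smul_of_fixed`, `discr_charpoly_of_trace_eq_zero`, `strictEstimate_of_hasStrictFDerivAt`) and its whole ★ import chain (D2♭, FILE 2′, FILE 3, (C0), D1)
import Summits.HodgeConjecture.HodgeConjecture.Theorems.K2E3HCDGroupToLieRpow           -- ★ (ε5) p856877 (K2E3-p21): the dictionary `coe_rpow_neg_quarter` (`(↑x)^(−1∕4) = (↑√√x)⁻¹`)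
import Mathlib.Analysis.SpecialFunctions.Pow.Continuity
import HarnessLib

/-!
# K2 · E3 · (SC-an) sub-line «HC-D-ε», file (ε1): REGULAR POINTS ON `↥𝔲₀` AT A REAL EXPONENT `r` — `|η|^{−r}` is integrable near every REGULAR point of the
# trace-zero skew-hermitian Lie algebra, GIVEN the cusp integrability of `|−4c³ − 27d²|^{−r}` on the coefficient group `A` (and, in fact, for ANY continuous weight)

Cell `pub/hodgecm-mathlib`, crux H413 = `stmt-HodgeConjecture-24833` (lane `--supports … --as helper`, count-neutral); (SC-an) line lead K2E3-p14 (g3), dealer K2E3-plan (g2),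
HC-D-ε sub-lead K2E3-p21 (g3).  THEOREMS ONLY (no `def` ∕ `instance` ∕ `notation` ∕ named fact ∕ `sorry`); ★-only imports.

WHY.  The (SC-dom) weight `W = c·|D_G|^{−1∕2}(1 + |log|D_G||)^k` of ★ p856355 needs `|D_G|^{−(1+δ)∕2} ∈ L¹_loc` (★ p856410 `locallyIntegrable_inv_mul_log_pow`), i.e.
Harish-Chandra's Theorem 15 at an exponent SLIGHTLY ABOVE the road's `1∕2`; the ★ road «HC-D» is typed at the frozen exponent (`√√` of the `normAbs K`-tokens =
the power `−1∕4`), so the sub-line re-types it at `((x : ℝ≥0∞)) ^ (−r)` (CONVENTION v1 (T1)).  THIS FILE is the regular-point brick D5(i): the ★ proof (F0P3-p04) —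
LH1-p03 FILE 3 strict derivative of `χ′ = (tr ∘ adj, det)` → ★ D2♭ Newton data on the additive subgroup `𝔲₀` → ★ FILE 2′ depth chart → ★ (C0) additive submersion bound
along `E : ↥𝔲₀ ≃ₜ+ ↥A × ker` → translations — never looks inside the weight: it pulls back ANY Borel weight `Φ` on the coefficient group through the Chevalley map
`X ↦ (tr adj X, det X)`.  So §1 proves the brick for an arbitrary CONTINUOUS `Φ : K × K → [0, ∞]` (`exists_nhds_setLIntegral_comp_chevalley_lt_top`, the ★ proof
verbatim with `Φ` for the frozen token), §2 specialises to the (T1) token `Φ (c, d) = (↑|−4c³ − 27d²|_K)^(−r)` and rewrites `discr (charpoly X) = −4 (tr adj X)³ − 27 (det X)²`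
on trace-zero `X` (★ `discr_charpoly_of_trace_eq_zero`) — the HEAD **`exists_nhds_setLIntegral_eta_rpow_lt_top`** = ★ D5(i)'s binders VERBATIM with `{r : ℝ}` inserted before
`hcusp` (no sign or size condition on `r` is needed at this brick; `12 r < 5` enters only through the cusp leaf ★ (D3c) upstream) — and §3 checks consistency at
`r = 1∕4`: the (T1) statement there is the ★ head read through ★ (ε5) `coe_rpow_neg_quarter` (`exists_nhds_setLIntegral_eta_rpow_quarter_lt_top`).

Frame (road rulings R1–R5, R3♭, as ★ D5(i)): `K` a non-archimedean local field; `σ` an involution, `(J.map σ)ᵀ = J`, `IsUnit J.det`, `(2 : K) ≠ 0`, a skew unit `λ`;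
`𝔲₀ ≤ M₃(K)` the trace-zero skew-hermitian additive subgroup (`h𝔲₀`), `A ≤ K × K` the coefficient group (`hA`), both closed; additive Haar measures `μ`, `ν`; regularity
`LinearIndependent K ![1, X₀, X₀²]`.

HONEST LABEL: HC_CM is proved only modulo the 7 printed citations (2 remaining named inputs: hLiu418 = `stmt-HodgeConjecture-24832`, h413 = `stmt-HodgeConjecture-24833`)
until rung 0 closes; count-neutral helper ((ε1) of 8 files of the HC-D-ε sub-line; (SC-an) is NOT ★).

## References
* [HarishChandra1970] Harish-Chandra (notes by G. van Dijk), *Harmonic Analysis on Reductive p-adic Groups*, LNM 162 (1970), Part VII §1 Theorem 15 p. 63 (the exponent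
  `−1∕2 − ε`), §3 p. 73; Part V §4 Lemma 22.
* [Schikhof1984] W. H. Schikhof, *Ultrametric Calculus* (1984), §27 Lemma 27.4–Thm. 27.5 (Newton charts).
* [DeitmarEchterhoff2014] A. Deitmar, S. Echterhoff, *Principles of Harmonic Analysis*, 2nd ed. (2014), Thm. 1.5.3.
-/

set_option autoImplicit false
-- the mandated namespace has the single-problem summit's repeated segment (`HodgeConjecture.HodgeConjecture`)
set_option linter.dupNamespace false

noncomputable section

open MeasureTheory Filter Metric Set Topology Matrix
open scoped ENNReal NNReal Pointwise
open Literature.NumberTheory.GaloisRepresentations Literature.NumberTheory.GaloisRepresentations.IsNonarchimedeanLocalField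
open Literature.MeasureTheory.Group Literature.Analysis.Calculus
open Summit.HodgeConjecture.HodgeConjecture.Cruxes.H413.F0P3cStCharTSSubmersionDescent
open Summit.HodgeConjecture.HodgeConjecture.Cruxes.H413.F0P3cStCharTSNewtonCore
open Summit.HodgeConjecture.HodgeConjecture.Cruxes.H413.F0P3cStCharTSChevalleyDifferential
open Summit.HodgeConjecture.HodgeConjecture.Cruxes.H413.F0P3cStCharTSHCDRegularPoints
open Summit.HodgeConjecture.HodgeConjecture.Cruxes.H413.K2E3HCDGroupToLieRpow

namespace Summit.HodgeConjecture.HodgeConjecture.Cruxes.H413.K2E3HCDRegularPointsRpow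

/-! ## §1 The regular-point brick for an ARBITRARY continuous weight on the coefficient group -/

/-- **D5(i) FOR ANY CONTINUOUS WEIGHT.**  In the road's scalar-free frame: if a continuous `Φ : K × K → [0, ∞]` has finite `ν`-integral near every point of the
coefficient group `↥A` (`hcusp`), then for every REGULAR `X₀ : ↥𝔲₀` (`1, X₀, X₀²` independent) the pulled-back weight `X ↦ Φ (tr adj X, det X)` has finite `μ`-integral on
a neighbourhood of `X₀` in `↥𝔲₀` — the ★ D5(i) proof VERBATIM (FILE 3 strict derivative → ★ D2♭ → ★ FILE 2′ → ★ (C0) → translations), which never inspects the weight.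
[cite: HarishChandra1970, Part VII §1 Thm. 15] [cite: Schikhof1984, §27 Lemma 27.4–Thm. 27.5] [cite: DeitmarEchterhoff2014, Thm. 1.5.3] -/
theorem exists_nhds_setLIntegral_comp_chevalley_lt_top
    {K : Type*} [Field K] [ValuativeRel K] [TopologicalSpace K] [IsNonarchimedeanLocalField K]
    (σ : K →+* K) (hσ : ∀ x, σ (σ x) = x) {J : Matrix (Fin 3) (Fin 3) K} (hJσ : (J.map σ)ᵀ = J) (hJ : IsUnit J.det)
    (h2 : (2 : K) ≠ 0) (lam : Kˣ) (hlam : σ (lam : K) = -(lam : K))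
    (𝔲₀ : AddSubgroup (Matrix (Fin 3) (Fin 3) K)) (h𝔲₀ : ∀ X, X ∈ 𝔲₀ ↔ (X.map σ)ᵀ * J + J * X = 0 ∧ trace X = 0)
    (h𝔲₀c : IsClosed (𝔲₀ : Set (Matrix (Fin 3) (Fin 3) K)))
    [MeasurableSpace ↥𝔲₀] [BorelSpace ↥𝔲₀] (μ : Measure ↥𝔲₀) [μ.IsAddHaarMeasure]
    (A : AddSubgroup (K × K)) (hA : ∀ p : K × K, p ∈ A ↔ σ p.1 = p.1 ∧ σ p.2 = -p.2) (hAc : IsClosed (A : Set (K × K)))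
    [MeasurableSpace ↥A] [BorelSpace ↥A] (ν : Measure ↥A) [ν.IsAddHaarMeasure]
    {Φ : K × K → ℝ≥0∞} (hΦ : Continuous Φ)
    (hcusp : ∀ a₀ : ↥A, ∃ W ∈ 𝓝 a₀, ∫⁻ a in W, Φ (a : K × K) ∂ν < ∞)
    (X₀ : ↥𝔲₀) (hreg : LinearIndependent K ![(1 : Matrix (Fin 3) (Fin 3) K), (X₀ : Matrix (Fin 3) (Fin 3) K), (X₀ : Matrix (Fin 3) (Fin 3) K) ^ 2]) :
    ∃ U ∈ 𝓝 X₀, ∫⁻ X in U, Φ (trace (adjugate (X : Matrix (Fin 3) (Fin 3) K)), det (X : Matrix (Fin 3) (Fin 3) K)) ∂μ < ∞ := by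
  classical
  -- ===== R1 frame, inside the proof only =====
  letI : NontriviallyNormedField K := IsNonarchimedeanLocalField.nontriviallyNormedField K
  haveI : CompleteSpace K := IsNonarchimedeanLocalField.completeSpace_nontriviallyNormedField K
  haveI : IsUltrametricDist K := IsNonarchimedeanLocalField.isUltrametricDist_nontriviallyNormedField K
  haveI : ProperSpace K := ProperSpace.of_nontriviallyNormedField_of_weaklyLocallyCompactSpace K
  haveI : SecondCountableTopology K := secondCountable_of_proper
  haveI : SecondCountableTopology (Matrix (Fin 3) (Fin 3) K) := inferInstanceAs (SecondCountableTopology (Fin 3 → Fin 3 → K))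
  letI : NormedAddCommGroup (Matrix (Fin 3) (Fin 3) K) := Matrix.normedAddCommGroup
  letI : NormedSpace K (Matrix (Fin 3) (Fin 3) K) := Matrix.normedSpace
  haveI : IsUltrametricDist (Matrix (Fin 3) (Fin 3) K) := inferInstanceAs (IsUltrametricDist (Fin 3 → Fin 3 → K))
  haveI : ProperSpace (Matrix (Fin 3) (Fin 3) K) := inferInstanceAs (ProperSpace (Fin 3 → Fin 3 → K))
  haveI : Invertible (2 : K) := invertibleOfNonzero h2
  haveI : ProperSpace ↥𝔲₀ := ProperSpace.of_isClosed h𝔲₀c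
  haveI : LocallyCompactSpace (Matrix (Fin 3) (Fin 3) K) := inferInstanceAs (LocallyCompactSpace (Fin 3 → Fin 3 → K))
  haveI : LocallyCompactSpace ↥𝔲₀ := h𝔲₀c.isClosedEmbedding_subtypeVal.locallyCompactSpace
  haveI : LocallyCompactSpace ↥A := hAc.isClosedEmbedding_subtypeVal.locallyCompactSpace
  -- ===== the data at `X₀` =====
  have hX₀ : ((X₀ : Matrix (Fin 3) (Fin 3) K).map σ)ᵀ * J + J * (X₀ : Matrix (Fin 3) (Fin 3) K) = 0 ∧ trace (X₀ : Matrix (Fin 3) (Fin 3) K) = 0 :=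
    (h𝔲₀ _).1 X₀.2
  have hmem : ∀ s : ↥𝔲₀, ((s : Matrix (Fin 3) (Fin 3) K).map σ)ᵀ * J + J * (s : Matrix (Fin 3) (Fin 3) K) = 0 ∧ trace (s : Matrix (Fin 3) (Fin 3) K) = 0 :=
    fun s => (h𝔲₀ _).1 s.2
  -- ===== `P = (tr ∘ adj, det)` and its strict differential (FILE 3) =====
  obtain ⟨L₂, hL₂, hd₂⟩ := Literature.LinearAlgebra.Matrix.CubicChevalleyStrictDeriv.hasStrictFDerivAt_trace_adjugate (X₀ : Matrix (Fin 3) (Fin 3) K)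
  obtain ⟨L₃, hL₃, hd₃⟩ := Literature.LinearAlgebra.Matrix.CubicChevalleyStrictDeriv.hasStrictFDerivAt_det (X₀ : Matrix (Fin 3) (Fin 3) K)
  set P : Matrix (Fin 3) (Fin 3) K → K × K := fun Y => (trace (adjugate Y), det Y) with hPdef
  set L' : Matrix (Fin 3) (Fin 3) K →L[K] K × K := L₂.prod L₃ with hL'def
  have hL' : ∀ Y, L' Y = (trace (X₀ : Matrix (Fin 3) (Fin 3) K) * trace Y - trace ((X₀ : Matrix (Fin 3) (Fin 3) K) * Y),
      trace (adjugate (X₀ : Matrix (Fin 3) (Fin 3) K) * Y)) := fun Y => by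
    simp only [hL'def, ContinuousLinearMap.prod_apply, hL₂, hL₃]
  have hPd : HasStrictFDerivAt P L' (X₀ : Matrix (Fin 3) (Fin 3) K) := hd₂.prodMk hd₃
  set L : Matrix (Fin 3) (Fin 3) K →+ K × K := (L' : Matrix (Fin 3) (Fin 3) K →ₗ[K] K × K).toAddMonoidHom with hLdef
  have hLL : ∀ Y, L Y = L' Y := fun Y => rfl
  -- the `ε–δ` strict estimate
  have hP := strictEstimate_of_hasStrictFDerivAt hPd
  -- ===== `P` and `L` map `𝔲₀` into the coefficient group `A` =====
  have hPA : ∀ Y : Matrix (Fin 3) (Fin 3) K, (Y.map σ)ᵀ * J + J * Y = 0 → P Y ∈ A := fun Y hY =>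
    (hA _).2 ⟨sigma_trace_adjugate_of_mem σ hJ hY, sigma_det_of_mem σ hJ hY⟩
  have hPS : ∀ s : ↥𝔲₀, P ((X₀ : Matrix (Fin 3) (Fin 3) K) + s) - P X₀ ∈ A :=
    fun s => A.sub_mem (hPA _ ((h𝔲₀ _).1 (𝔲₀.add_mem X₀.2 s.2)).1) (hPA _ hX₀.1)
  have hLS : ∀ s : ↥𝔲₀, L (s : Matrix (Fin 3) (Fin 3) K) ∈ A := by
    intro s
    rw [hLL, hL', (hmem s).2, mul_zero, zero_sub]
    refine (hA _).2 ⟨?_, ?_⟩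
    · rw [map_neg, sigma_trace_mul_of_mem σ hJ hX₀.1 (hmem s).1]
    · exact sigma_trace_adjugate_mul_of_mem σ hJ hX₀.1 (hmem s).1
  -- ===== the bounded additive section `t (c, d) = c • Y₁ + (d·λ⁻¹) • Y₂` =====
  obtain ⟨Y₁, hY₁s, hY₁t, hY₁c, hY₁d⟩ := exists_mem_trace_zero_differential_eq_of_linearIndependent σ hσ hJσ hJ hX₀.1 hreg
    1 0 (map_one σ) (by rw [map_zero, neg_zero])
  obtain ⟨Y₂, hY₂s, hY₂t, hY₂c, hY₂d⟩ := exists_mem_trace_zero_differential_eq_of_linearIndependent σ hσ hJσ hJ hX₀.1 hreg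
    0 (lam : K) (map_zero σ) hlam
  have hlam0 : (lam : K) ≠ 0 := lam.ne_zero
  have hfix : ∀ a : ↥A, σ ((a : K × K).2 * (lam : K)⁻¹) = (a : K × K).2 * (lam : K)⁻¹ := by
    intro a
    rw [map_mul, map_inv₀, ((hA _).1 a.2).2, hlam, inv_neg, neg_mul_neg]
  have htmem : ∀ a : ↥A, (a : K × K).1 • Y₁ + ((a : K × K).2 * (lam : K)⁻¹) • Y₂ ∈ 𝔲₀ := by
    intro a
    refine 𝔲₀.add_mem ((h𝔲₀ _).2 ⟨skew_smul_of_fixed σ ((hA _).1 a.2).1 hY₁s, ?_⟩) ((h𝔲₀ _).2 ⟨skew_smul_of_fixed σ (hfix a) hY₂s, ?_⟩)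
    · rw [trace_smul, hY₁t, smul_zero]
    · rw [trace_smul, hY₂t, smul_zero]
  set t : ↥A → ↥𝔲₀ := fun a => ⟨(a : K × K).1 • Y₁ + ((a : K × K).2 * (lam : K)⁻¹) • Y₂, htmem a⟩ with htdef
  have htcoe : ∀ a : ↥A, ((t a : ↥𝔲₀) : Matrix (Fin 3) (Fin 3) K) = (a : K × K).1 • Y₁ + ((a : K × K).2 * (lam : K)⁻¹) • Y₂ := fun a => rfl
  have ht : ∀ a b, t (a + b) = t a + t b := by
    intro a b
    apply Subtype.ext
    simp only [AddSubgroup.coe_add, htcoe, Prod.fst_add, Prod.snd_add, add_smul, add_mul]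
    abel
  have hLt : ∀ a : ↥A, L ((t a : ↥𝔲₀) : Matrix (Fin 3) (Fin 3) K) = (a : K × K) := by
    intro a
    rw [htcoe, map_add, hLL, hLL, map_smul, map_smul, hL', hL', hY₁c, hY₁d, hY₂c, hY₂d]
    ext <;> simp [hlam0]
  have hC : ∀ a : ↥A, ‖((t a : ↥𝔲₀) : Matrix (Fin 3) (Fin 3) K)‖ ≤ (‖Y₁‖ + ‖(lam : K)⁻¹‖ * ‖Y₂‖) * ‖(a : K × K)‖ := by
    intro a
    rw [htcoe]
    have h1 : ‖(a : K × K).1‖ ≤ ‖(a : K × K)‖ := norm_fst_le _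
    have h2 : ‖(a : K × K).2‖ ≤ ‖(a : K × K)‖ := norm_snd_le _
    calc ‖(a : K × K).1 • Y₁ + ((a : K × K).2 * (lam : K)⁻¹) • Y₂‖
        ≤ ‖(a : K × K).1 • Y₁‖ + ‖((a : K × K).2 * (lam : K)⁻¹) • Y₂‖ := norm_add_le _ _
      _ = ‖(a : K × K).1‖ * ‖Y₁‖ + ‖(a : K × K).2‖ * ‖(lam : K)⁻¹‖ * ‖Y₂‖ := by rw [norm_smul, norm_smul, norm_mul]
      _ ≤ ‖(a : K × K)‖ * ‖Y₁‖ + ‖(a : K × K)‖ * ‖(lam : K)⁻¹‖ * ‖Y₂‖ := by gcongr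
      _ = (‖Y₁‖ + ‖(lam : K)⁻¹‖ * ‖Y₂‖) * ‖(a : K × K)‖ := by ring
  -- ===== D2♭: Newton data on `↥𝔲₀` =====
  obtain ⟨E, Ψ, hE1, hE2, hEsymm, hΨ1, hΨ2, hΨ0, hN⟩ :=
    exists_newtonData_submersion_addSubgroup 𝔲₀ A P L L'.continuous (X₀ : Matrix (Fin 3) (Fin 3) K) hP hPS hLS t ht hLt hC
  -- ===== FILE 2′: the chart on deep balls of `↥𝔲₀` =====
  letI : MeasurableSpace ↥(L.comp 𝔲₀.subtype).ker := borel _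
  haveI : BorelSpace ↥(L.comp 𝔲₀.subtype).ker := ⟨rfl⟩
  obtain ⟨Λ, hΛ⟩ := exists_addSubgroup_coe_eq_closedBall (V := ↥𝔲₀) one_pos (by norm_num : (0 : ℝ) < 1 / 2)
  obtain ⟨k₀, hk₀⟩ := hN one_pos (by norm_num : (0 : ℝ) < 1 / 2) (by norm_num : (1 / 2 : ℝ) < 1)
  -- Borel instances for the normed (defeq) topologies, passed explicitly
  have hBW : BorelSpace (↥A × ↥(L.comp 𝔲₀.subtype).ker) :=
    @Prod.borelSpace ↥A ↥(L.comp 𝔲₀.subtype).ker _ _ ‹BorelSpace ↥A› _ _ ‹BorelSpace ↥(L.comp 𝔲₀.subtype).ker› _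
  have hchart := @depth_chart_of_newtonData ↥𝔲₀ _ _ _ _ ‹BorelSpace ↥𝔲₀› (↥A × ↥(L.comp 𝔲₀.subtype).ker) _ _ hBW
    μ ‹μ.IsAddHaarMeasure›.toIsFiniteMeasureOnCompacts ‹μ.IsAddHaarMeasure›.toIsAddLeftInvariant _ _ E _ _ _ hΛ one_pos
    (by norm_num : (0 : ℝ) < 1 / 2) (by norm_num : (1 / 2 : ℝ) < 1) _ hk₀
  -- ===== the kernel is a closed subgroup, hence locally compact =====
  have hkerc : IsClosed (((L.comp 𝔲₀.subtype).ker : AddSubgroup ↥𝔲₀) : Set ↥𝔲₀) := by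
    have hc : Continuous fun s : ↥𝔲₀ => L' (s : Matrix (Fin 3) (Fin 3) K) := L'.continuous.comp continuous_subtype_val
    have hset : (((L.comp 𝔲₀.subtype).ker : AddSubgroup ↥𝔲₀) : Set ↥𝔲₀) = (fun s : ↥𝔲₀ => L' (s : Matrix (Fin 3) (Fin 3) K)) ⁻¹' {0} := by
      ext s; simp [AddMonoidHom.mem_ker, hLL]
    rw [hset]; exact isClosed_singleton.preimage hc
  have hkerlc : LocallyCompactSpace ↥(L.comp 𝔲₀.subtype).ker := hkerc.isClosedEmbedding_subtypeVal.locallyCompactSpace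
  -- ===== the cusp integrand on `↥A`, its measurability, the base point =====
  set Δ : ↥A → ℝ≥0∞ := fun a => Φ (a : K × K) with hΔ
  have hΔm : Measurable Δ := (hΦ.comp continuous_subtype_val).measurable
  have ha₀A : P (X₀ : Matrix (Fin 3) (Fin 3) K) ∈ A := hPA _ hX₀.1
  set a₀ : ↥A := ⟨P (X₀ : Matrix (Fin 3) (Fin 3) K), ha₀A⟩ with ha₀
  obtain ⟨W, hW, hWfin⟩ := hcusp a₀
  set g : ↥A → ℝ≥0∞ := fun a => Δ (a₀ + a) with hg
  have hgm : Measurable g := hΔm.comp (measurable_const_add a₀)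
  -- ===== depth: `fst (E (Λ k))` inside the translated cusp neighbourhood =====
  have hV₀ : (fun a : ↥A => a₀ + a) ⁻¹' W ∈ 𝓝 (0 : ↥A) := by
    have hc : Continuous fun a : ↥A => a₀ + a := continuous_const.add continuous_id
    refine hc.continuousAt.preimage_mem_nhds ?_
    rw [add_zero]; exact hW
  have hE0 : (fun s : ↥𝔲₀ => (E s).1) ⁻¹' ((fun a : ↥A => a₀ + a) ⁻¹' W) ∈ 𝓝 (0 : ↥𝔲₀) := by
    have hc : Continuous fun s : ↥𝔲₀ => (E s).1 := continuous_fst.comp E.continuous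
    refine hc.continuousAt.preimage_mem_nhds ?_
    rw [map_zero, Prod.fst_zero]; exact hV₀
  obtain ⟨k₁, hk₁⟩ := exists_subset_of_mem_nhds_of_coe_eq_closedBall hΛ one_pos (by norm_num : (1 / 2 : ℝ) < 1) _ hE0
  set k := max k₀ k₁ with hk
  obtain ⟨-, -, -, hint⟩ := hchart k (le_max_left _ _)
  have hΛsub : (Λ k : Set ↥𝔲₀) ⊆ (fun s : ↥𝔲₀ => (E s).1) ⁻¹' ((fun a : ↥A => a₀ + a) ⁻¹' W) :=
    (SetLike.coe_subset_coe.2 (antitone_of_coe_eq_closedBall hΛ zero_le_one (by norm_num) (by norm_num) (le_max_right k₀ k₁))).trans hk₁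
  -- ===== (C0) on the compact ball `Λ k` =====
  haveI hsc𝔲 : SecondCountableTopology ↥𝔲₀ := TopologicalSpace.Subtype.secondCountableTopology _
  haveI hscker : SecondCountableTopology ↥(L.comp 𝔲₀.subtype).ker := TopologicalSpace.Subtype.secondCountableTopology _
  obtain ⟨C₀, hC₀, hbound⟩ := @exists_setLIntegral_fst_le_of_continuousAddEquiv ↥𝔲₀ ↥A ↥(L.comp 𝔲₀.subtype).ker
    _ _ _ _ ‹BorelSpace ↥𝔲₀› _ _ _ ‹LocallyCompactSpace ↥A› _ _ ‹BorelSpace ↥A› _ _ _ hkerlc hscker _ ‹BorelSpace ↥(L.comp 𝔲₀.subtype).ker›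
    E μ ‹μ.IsAddHaarMeasure› ν ‹ν.IsAddHaarMeasure› _ (isCompact_of_coe_eq_closedBall hΛ k)
  -- ===== the neighbourhood `U = X₀ + Λ k` =====
  have hΛk0 : (Λ k : Set ↥𝔲₀) ∈ 𝓝 (0 : ↥𝔲₀) := by
    rw [hΛ]; exact closedBall_mem_nhds _ (by positivity)
  refine ⟨(fun v : ↥𝔲₀ => X₀ + v) '' (Λ k : Set ↥𝔲₀), ?_, ?_⟩
  · have h := (Homeomorph.addLeft X₀).isOpenMap.image_mem_nhds hΛk0
    simpa using h
  -- ===== the chain of (in)equalities =====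
  have hη : (fun X : ↥𝔲₀ => Φ (trace (adjugate (X : Matrix (Fin 3) (Fin 3) K)), det (X : Matrix (Fin 3) (Fin 3) K)))
      = fun X : ↥𝔲₀ => Φ (P (X : Matrix (Fin 3) (Fin 3) K)) := by
    funext X; simp only [hPdef]
  rw [hη]
  -- translate `μ`
  have e1 : ∫⁻ v in (Λ k : Set ↥𝔲₀), Φ (P ((X₀ + v : ↥𝔲₀) : Matrix (Fin 3) (Fin 3) K)) ∂μ
      = ∫⁻ X in (fun v : ↥𝔲₀ => X₀ + v) '' (Λ k : Set ↥𝔲₀), Φ (P (X : Matrix (Fin 3) (Fin 3) K)) ∂μ :=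
    (measurePreserving_add_left μ X₀).setLIntegral_comp_emb (MeasurableEquiv.addLeft X₀).measurableEmbedding
      (fun X : ↥𝔲₀ => Φ (P (X : Matrix (Fin 3) (Fin 3) K))) _
  rw [← e1]
  -- the chart: `Φ (P (X₀ + v)) = f (Ψ v)` with `f w = g w.1`
  set f : ↥A × ↥(L.comp 𝔲₀.subtype).ker → ℝ≥0∞ := fun w => g w.1 with hf
  have hfm : Measurable f := hgm.comp measurable_fst
  have e2 : (fun v : ↥𝔲₀ => Φ (P ((X₀ + v : ↥𝔲₀) : Matrix (Fin 3) (Fin 3) K))) = fun v => f (Ψ (0 + v)) := by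
    funext v
    simp only [hf, hg, hΔ, ha₀, zero_add, AddSubgroup.coe_add, hΨ1, add_sub_cancel]
  rw [e2, hint f hfm, hΨ0]
  have e3 : (fun v : ↥𝔲₀ => f (0 + E v)) = fun v => g (E v).1 := by
    funext v; simp only [hf, zero_add]
  rw [e3]
  refine lt_of_le_of_lt (hbound g hgm) (ENNReal.mul_lt_top hC₀ ?_)
  -- translate `ν` and enlarge to `W`
  have e4 : ∫⁻ a in Prod.fst '' ((E : ↥𝔲₀ → ↥A × ↥(L.comp 𝔲₀.subtype).ker) '' (Λ k : Set ↥𝔲₀)), g a ∂ν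
      = ∫⁻ b in (fun a : ↥A => a₀ + a) '' (Prod.fst '' ((E : ↥𝔲₀ → ↥A × ↥(L.comp 𝔲₀.subtype).ker) '' (Λ k : Set ↥𝔲₀))), Δ b ∂ν :=
    (measurePreserving_add_left ν a₀).setLIntegral_comp_emb (MeasurableEquiv.addLeft a₀).measurableEmbedding Δ _
  have hsub : (fun a : ↥A => a₀ + a) '' (Prod.fst '' ((E : ↥𝔲₀ → ↥A × ↥(L.comp 𝔲₀.subtype).ker) '' (Λ k : Set ↥𝔲₀))) ⊆ W := by
    rintro _ ⟨a, ⟨w, ⟨s, hs, rfl⟩, rfl⟩, rfl⟩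
    exact hΛsub hs
  exact lt_of_le_of_lt ((le_of_eq e4).trans (lintegral_mono_set hsub)) hWfin

/-! ## §2 The (T1) head: the weight `|discr χ_X|^{−r}` -/

/-- **(ε1) «REGULAR POINTS ON `↥𝔲₀`» AT A REAL EXPONENT `r`** (★ D5(i) `exists_nhds_setLIntegral_etaIota_lt_top` with `{r : ℝ}` inserted before `hcusp`, tokens (T1) of
CONVENTION v1): if the cusp weight `(c, d) ↦ (↑|−4c³ − 27d²|_K)^(−r)` has finite `ν`-integral near every point of `↥A`, then for every REGULAR `X₀ : ↥𝔲₀` the Weyl-discriminant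
weight `X ↦ (↑|discr (charpoly X)|_K)^(−r)` has finite `μ`-integral near `X₀` (§1 at this weight; on trace-zero `X`, `discr (charpoly X) = −4 (tr adj X)³ − 27 (det X)²`,
★ `discr_charpoly_of_trace_eq_zero`).  No condition on `r` here. [cite: HarishChandra1970, Part VII §1 Thm. 15 p. 63] [cite: Schikhof1984, §27] -/
theorem exists_nhds_setLIntegral_eta_rpow_lt_top
    {K : Type*} [Field K] [ValuativeRel K] [TopologicalSpace K] [IsNonarchimedeanLocalField K]
    (σ : K →+* K) (hσ : ∀ x, σ (σ x) = x) {J : Matrix (Fin 3) (Fin 3) K} (hJσ : (J.map σ)ᵀ = J) (hJ : IsUnit J.det)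
    (h2 : (2 : K) ≠ 0) (lam : Kˣ) (hlam : σ (lam : K) = -(lam : K))
    (𝔲₀ : AddSubgroup (Matrix (Fin 3) (Fin 3) K)) (h𝔲₀ : ∀ X, X ∈ 𝔲₀ ↔ (X.map σ)ᵀ * J + J * X = 0 ∧ trace X = 0)
    (h𝔲₀c : IsClosed (𝔲₀ : Set (Matrix (Fin 3) (Fin 3) K)))
    [MeasurableSpace ↥𝔲₀] [BorelSpace ↥𝔲₀] (μ : Measure ↥𝔲₀) [μ.IsAddHaarMeasure]
    (A : AddSubgroup (K × K)) (hA : ∀ p : K × K, p ∈ A ↔ σ p.1 = p.1 ∧ σ p.2 = -p.2) (hAc : IsClosed (A : Set (K × K)))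
    [MeasurableSpace ↥A] [BorelSpace ↥A] (ν : Measure ↥A) [ν.IsAddHaarMeasure] {r : ℝ}
    (hcusp : ∀ a₀ : ↥A, ∃ W ∈ 𝓝 a₀, ∫⁻ a in W,
      ((normAbs K (-4 * (a : K × K).1 ^ 3 - 27 * (a : K × K).2 ^ 2) : ℝ≥0∞)) ^ (-r) ∂ν < ∞)
    (X₀ : ↥𝔲₀) (hreg : LinearIndependent K ![(1 : Matrix (Fin 3) (Fin 3) K), (X₀ : Matrix (Fin 3) (Fin 3) K), (X₀ : Matrix (Fin 3) (Fin 3) K) ^ 2]) :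
    ∃ U ∈ 𝓝 X₀, ∫⁻ X in U, ((normAbs K (Matrix.charpoly (X : Matrix (Fin 3) (Fin 3) K)).discr : ℝ≥0∞)) ^ (-r) ∂μ < ∞ := by
  have hpoly : Continuous fun p : K × K => (-4 * p.1 ^ 3 - 27 * p.2 ^ 2 : K) :=
    (continuous_const.mul (continuous_fst.pow 3)).sub (continuous_const.mul (continuous_snd.pow 2))
  have hΦ : Continuous fun p : K × K => ((normAbs K (-4 * p.1 ^ 3 - 27 * p.2 ^ 2) : ℝ≥0∞)) ^ (-r) :=
    ENNReal.continuous_rpow_const.comp (ENNReal.continuous_coe.comp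
      (Literature.NumberTheory.Automorphic.LocalFieldHaar.continuous_normAbs.comp hpoly))
  have hη : (fun X : ↥𝔲₀ => ((normAbs K (Matrix.charpoly (X : Matrix (Fin 3) (Fin 3) K)).discr : ℝ≥0∞)) ^ (-r)) =
      fun X : ↥𝔲₀ => (fun p : K × K => ((normAbs K (-4 * p.1 ^ 3 - 27 * p.2 ^ 2) : ℝ≥0∞)) ^ (-r))
        (trace (adjugate (X : Matrix (Fin 3) (Fin 3) K)), det (X : Matrix (Fin 3) (Fin 3) K)) := by
    funext X
    simp only [discr_charpoly_of_trace_eq_zero _ ((h𝔲₀ _).1 X.2).2]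
  rw [hη]
  exact exists_nhds_setLIntegral_comp_chevalley_lt_top σ hσ hJσ hJ h2 lam hlam 𝔲₀ h𝔲₀ h𝔲₀c μ A hA hAc ν hΦ hcusp X₀ hreg

/-! ## §3 Consistency at the ★ exponent `r = 1∕4` -/

/-- **(ε1) AT `r = 1∕4` IS ★ D5(i) READ THROUGH THE DICTIONARY.**  The (T1) statement at `r = 1∕4`, derived from the frozen-exponent head ★
`F0P3cStCharTSHCDRegularPoints.exists_nhds_setLIntegral_etaIota_lt_top` (tokens `(↑√√·)⁻¹`) by ★ (ε5) `coe_rpow_neg_quarter` alone — the twin §2 is a literal generalisation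
(the converse reading, ★ from §2, is the same `simp only`; the ★ statement itself is not restated here). [cite: HarishChandra1970, Part VII §1 Thm. 15] -/
theorem exists_nhds_setLIntegral_eta_rpow_quarter_lt_top
    {K : Type*} [Field K] [ValuativeRel K] [TopologicalSpace K] [IsNonarchimedeanLocalField K]
    (σ : K →+* K) (hσ : ∀ x, σ (σ x) = x) {J : Matrix (Fin 3) (Fin 3) K} (hJσ : (J.map σ)ᵀ = J) (hJ : IsUnit J.det)
    (h2 : (2 : K) ≠ 0) (lam : Kˣ) (hlam : σ (lam : K) = -(lam : K))
    (𝔲₀ : AddSubgroup (Matrix (Fin 3) (Fin 3) K)) (h𝔲₀ : ∀ X, X ∈ 𝔲₀ ↔ (X.map σ)ᵀ * J + J * X = 0 ∧ trace X = 0)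
    (h𝔲₀c : IsClosed (𝔲₀ : Set (Matrix (Fin 3) (Fin 3) K)))
    [MeasurableSpace ↥𝔲₀] [BorelSpace ↥𝔲₀] (μ : Measure ↥𝔲₀) [μ.IsAddHaarMeasure]
    (A : AddSubgroup (K × K)) (hA : ∀ p : K × K, p ∈ A ↔ σ p.1 = p.1 ∧ σ p.2 = -p.2) (hAc : IsClosed (A : Set (K × K)))
    [MeasurableSpace ↥A] [BorelSpace ↥A] (ν : Measure ↥A) [ν.IsAddHaarMeasure]
    (hcusp : ∀ a₀ : ↥A, ∃ W ∈ 𝓝 a₀, ∫⁻ a in W,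
      ((normAbs K (-4 * (a : K × K).1 ^ 3 - 27 * (a : K × K).2 ^ 2) : ℝ≥0∞)) ^ (-(1 / 4 : ℝ)) ∂ν < ∞)
    (X₀ : ↥𝔲₀) (hreg : LinearIndependent K ![(1 : Matrix (Fin 3) (Fin 3) K), (X₀ : Matrix (Fin 3) (Fin 3) K), (X₀ : Matrix (Fin 3) (Fin 3) K) ^ 2]) :
    ∃ U ∈ 𝓝 X₀, ∫⁻ X in U, ((normAbs K (Matrix.charpoly (X : Matrix (Fin 3) (Fin 3) K)).discr : ℝ≥0∞)) ^ (-(1 / 4 : ℝ)) ∂μ < ∞ := by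
  have hcusp' : ∀ a₀ : ↥A, ∃ W ∈ 𝓝 a₀, ∫⁻ a in W,
      ((NNReal.sqrt (NNReal.sqrt (normAbs K (-4 * (a : K × K).1 ^ 3 - 27 * (a : K × K).2 ^ 2))) : ℝ≥0∞))⁻¹ ∂ν < ∞ := by
    simpa only [coe_rpow_neg_quarter] using hcusp
  simpa only [coe_rpow_neg_quarter] using
    F0P3cStCharTSHCDRegularPoints.exists_nhds_setLIntegral_etaIota_lt_top σ hσ hJσ hJ h2 lam hlam 𝔲₀ h𝔲₀ h𝔲₀c μ A hA hAc ν hcusp' X₀ hreg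

end Summit.HodgeConjecture.HodgeConjecture.Cruxes.H413.K2E3HCDRegularPointsRpow

end
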